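import Literature.MathematicalPhysics.QuantumFieldTheory.ONArchipelagoTwoSignHead
import Literature.MathematicalPhysics.QuantumFieldTheory.ConformalBootstrap3D.TwoSignHeadCellsHalf
import HarnessLib

/-!
# The first `T` cell of an `O(N)` archipelago point certificate: the scalar `T` row from `Δ = 1/2`

Addendum to `ONArchipelagoTwoSignHead.lean`.  In the default semidefinite program of the `O(N)`
archipelago (Kos–Poland–Simmons-Duffin–Vichi 2015, §3: `φ_i, s` the only relevant scalars in the
`V` and `S` sectors, NO assumption in the traceless-symmetric sector) the item `scalar_T` of
`ArchipelagoObligations` asks for `TensorPositive N` at every scalar `Δ ∈ [max(Δ_T^*, 1/2), E₀)` with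
`Δ_T^* ≤ 1/2`, i.e. from the unitarity bound itself.  The two-sign head cells of
`ConformalBootstrap3D/TwoSignHeadCells.lean` (monotone mode: `a ≥ 1`; interval mode: `a > 1/2`, tables
blowing up as `a ↓ 1/2`) leave the first cell `[1/2, t₁)` open; the HALF mode of
`ConformalBootstrap3D/TwoSignHeadCellsHalf.lean` (residue-scaled tables of `(4Δ - 2)·A_{n,j}`,
`HRCoeffHalfBoundTables`) closes it.

* `tensorCellH_of_headNumber` — one light `T` cell `[a, b)` with `1/2 ≤ a`, `τ ≤ a`, head level `n_F`
  (`a + n_F + 1 ≥ E₀`), term-rule bit `useChord`, from ONE number `headCellNumberH₂ ≥ 0` for the `T`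
  combined weights, under the same row data as `tensorCell_of_headNumber₂` (apex domination, (M) on
  `[E₀, E_T)`, the apex inequality (T), box width ratios);
* `scalar_T_from_bound_of_cells` — the item `scalar_T` with NO gap (`Δ_T^* ≤ 1/2`) from a cell list
  `t₀ = 1/2 < t₁ < … < t_m ≥ E₀` (cell `0` by the half mode, the others by any mode).

Sources: arXiv:1504.07997 §3 (`KosPolandSimmonsDuffinVichi2015`); F. Kos, D. Poland,
D. Simmons-Duffin, JHEP 06 (2014) 091, §2.1 (`KosPolandSimmonsduffin2014ON`); M. Hogervorst,
S. Rychkov, Phys. Rev. D 87 (2013) 106004, §3 eq. (3.9) (`HogervorstRychkov2013`).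
-/

noncomputable section

namespace Literature.MathematicalPhysics.QuantumFieldTheory.ONArchipelagoSystem

open Finset Set Filter Topology
open ConformalBootstrap3D (unitarityBound3D TwoSignPositive twoSignTerm apexRest₂ headCellNumberH₂
  headCellH₂_twoSign_of_rules)

namespace ArchipelagoFunctional

/-- **One light `T` cell touching the unitarity bound from its half-table number.** Dominated
configuration (apex `a₀` with `a⁻_{a₀} + a⁺_{a₀} ≥ 0` for the `T` combined weights),
`Q ⊆ [φ_lo, φ_hi] × ℝ`, the `T` tail rules in force — (M) termwise on `E ∈ [E₀, E_T)`, `j + τ ≤ E`,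
and the apex inequality (T) at `(φ_lo, E_T)` —, the box narrow enough: a scalar `Δ`-cell `[a, b)`
with `1/2 ≤ a` (the bound allowed), `τ ≤ a`, head level `n_F` (`a + n_F + 1 ≥ E₀`), term-rule bit
`useChord` with its side condition, and `headCellNumberH₂ ≥ 0` give `TensorPositive N` at every
`Δ ∈ [a, b)`, every `p ∈ Q`. [cite: KosPolandSimmonsDuffinVichi2015, §3] -/
theorem tensorCellH_of_headNumber {n : ℕ} (z zb : Fin n → ℝ) (w : Fin 7 → Fin n → ℝ) (N : ℕ)
    (hz : ∀ k, z k ∈ Ioo (0 : ℝ) 1) (hzb : ∀ k, zb k ∈ Ioo (0 : ℝ) 1) (hord : ∀ k, zb k ≤ z k)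
    (a₀ : Fin n) (hapex : 0 ≤ tensorMinusWeights w N a₀ + tensorPlusWeights w N a₀)
    (qd qr : Fin n → ℝ) (hqd : ∀ k, 0 < qd k ∧ qd k ≤ 1) (hqr : ∀ k, 0 < qr k ∧ qr k ≤ 1)
    (hdomd : ∀ k, z k * zb k ≤ qd k ^ 2 * (z a₀ * zb a₀) ∧ z k ≤ qd k * z a₀)
    (hdomr : ∀ k, (1 - z k) * (1 - zb k) ≤ qr k ^ 2 * (z a₀ * zb a₀) ∧ 1 - zb k ≤ qr k * z a₀)
    {Q : Set (ℝ × ℝ)} {φlo φhi E₀ ET τ : ℝ} (hQ : ∀ p ∈ Q, φlo ≤ p.1 ∧ p.1 ≤ φhi)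
    (hM : ∀ (j : ℕ) (E : ℝ), E₀ ≤ E → E < ET → (j : ℝ) + τ ≤ E → ∀ s ∈ Icc φlo φhi,
      0 ≤ twoSignTerm (tensorMinusWeights w N) (tensorPlusWeights w N) z zb s E j)
    (hB : apexRest₂ (tensorMinusWeights w N + tensorPlusWeights w N)
        (tensorMinusWeights w N - tensorPlusWeights w N) z zb a₀ qd qr φlo ET ≤
      (tensorMinusWeights w N a₀ + tensorPlusWeights w N a₀) * ((1 - z a₀) * (1 - zb a₀)) ^ φhi)
    (hr : ∀ k, 1 / 2 ≤ ((1 - z k) * (1 - zb k)) ^ (φhi - φlo) ∧ 1 / 2 ≤ (z k * zb k) ^ (φhi - φlo))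
    {a b : ℝ} (nF : ℕ) (hnF : E₀ ≤ a + ((nF : ℝ) + 1)) (useChord : Bool)
    (ha : 1 / 2 ≤ a) (haτ : τ ≤ a)
    (hρ : useChord = true → ∀ k, 1 / 2 ≤ (z k * zb k) ^ ((b - a) / 2) ∧
      1 / 2 ≤ ((1 - z k) * (1 - zb k)) ^ ((b - a) / 2))
    (hnum : 0 ≤ headCellNumberH₂ (tensorMinusWeights w N) (tensorPlusWeights w N) z zb a b φlo φhi
      nF useChord) :
    ∀ p ∈ Q, ∀ Δ ∈ Ico a b, (ofPoints z zb w).TensorPositive N p.1 Δ 0 :=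
  fun p hp Δ hΔ => (tensorPositive_ofPoints_iff_twoSignPositive z zb w N p.1 Δ 0).2
    (headCellH₂_twoSign_of_rules _ _ z zb hz hzb hord a₀ hapex qd qr hqd hqr hdomd hdomr hM hB hr
      nF hnF useChord ha haτ hρ hnum p.1 ⟨(hQ p hp).1, (hQ p hp).2⟩ Δ hΔ)

/-- **The item `scalar_T` with no gap assumption from a cell list starting at the bound**: cells
`[t_i, t_{i+1})`, `i < m`, with `t₀ ≤ 1/2` and `E₀ ≤ t_m` (cell `0` a half-table cell, so in fact
`t₀ = 1/2`), give `TensorPositive N` at every scalar `Δ` with `Δ_T^* ≤ Δ`, `1/2 ≤ Δ < E₀` — whatever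
`Δ_T^*` is. [cite: KosPolandSimmonsDuffinVichi2015, §3] -/
theorem scalar_T_from_bound_of_cells {n : ℕ} (z zb : Fin n → ℝ) (w : Fin 7 → Fin n → ℝ) (N : ℕ)
    {Q : Set (ℝ × ℝ)} {ΔTstar E₀ : ℝ} (t : ℕ → ℝ) (m : ℕ)
    (hlo : t 0 ≤ 1 / 2) (hhi : E₀ ≤ t m)
    (hcell : ∀ i < m, ∀ p ∈ Q, ∀ Δ ∈ Ico (t i) (t (i + 1)),
      (ofPoints z zb w).TensorPositive N p.1 Δ 0) :
    ∀ p ∈ Q, ∀ Δ : ℝ, ΔTstar ≤ Δ → 1 / 2 ≤ Δ → Δ < E₀ → (ofPoints z zb w).TensorPositive N p.1 Δ 0 :=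
  scalar_T_of_cells z zb w N t m (hlo.trans (le_max_right _ _)) hhi hcell

end ArchipelagoFunctional

end Literature.MathematicalPhysics.QuantumFieldTheory.ONArchipelagoSystem
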